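import Mathlib
import Literature.AlgebraicGeometry.Resolution.RegularCentreRsopPart
import Literature.NumberTheory.LFunctions.FordIncompleteSetup
import Summits.ResolutionOfSingularities.ResolutionOfSingularities.Theorems.FrobeniusClosingSteerLowOrderMatrix
import Summits.ResolutionOfSingularities.ResolutionOfSingularities.Theorems.FrobeniusClosingSteerLowOrderNormalForm

/-!
# Crux `Steer` (stmt-ResolutionOfSingularities-16345), σ-residual LOW half at `p = 2`:
# **`lowOrder_step_two` — LOW ORDER IS ABSORBING**, a SECOND, INDEPENDENT kernel proof (uniform argument)

The `step` binder of record is res-L0-w41-stub-2's `LowOrderAbsorbing.not_highOrder_of_step_two`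
(`…Theorems.FrobeniusClosingSteerLowOrderAbsorbing`, res-L0-w41-plan-1 RULING 34); this file is the second proof allowed by
RULING 34 (b) («land it as a second proof (no name clash)»), by a different route (cotangent-derivation kernel vector,
completing the product, quasi-regularity cross-term detector) — corroboration only, nothing in the skeleton depends on it.

OURS (campaign `res-hironaka`, rung L ★L-G4, slot W4.1, chain W4.1; seat `res-D-pv-028` g6 on res-L0-w41-plan-1 RULING 15
(15b) / RULING 34 (b); signature = res-L0-w41-tri-2's
`L/res-L0-w41-tri-2/s17/R2TwoSigma-s17-tri2.delta.lean` (sha16 9fa9f31c0b7a3a5b) l.33–41 with the run clause of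
`IsSteeredRun` and `IsHighOrderAt` UNFOLDED and the centre predicate generic (`Perm`; consumed: a permissible centre
has a regular quotient and an equimultiple cleaning `f − g² ∈ P²`) — the idle binders `t`, `hreg`, `hdim`, `hirr` of
the typed stub are dropped (the statement here is stronger); replaces the role of no printed item; NOT a statement
of the manuscript under review [claim: Hironaka2017, status: under-review]; AI review is weaker than expert review).
Same content as res-L0-w41-idea-3's C6 `LowAbsorbing`.

**Theorem.** Along a 2-steered run whose members are local rings at the centre of `O`, regular of dimension `4`
with square residues, if NO cleaning of the radicand `(s i)²` at stage `i` reaches `𝔪ᵢ³` (cleaned order exactly `2`),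
then no cleaning of `(s (i+1))²` reaches `𝔪ᵢ₊₁³`.

**Proof** (one uniform argument for every centre dimension; no base change, no rationality of the blown-up point):
`F := f − g_σ² ∈ P²` for the σ_top cleaner; `P = (u₁,…,u_h)` part of a regular system of parameters (tree
`exists_isRsopPart_span_range_eq`); `F = Σ G_{jk} u_j u_k` (`exists_matrix_of_mem_sq`); `¬High(i)` ⇒ some
`G_{jk} + G_{kj}` is a unit (`exists_unit_pair`, pairing `j < k`); reindex and COMPLETE THE PRODUCT
(`LowOrderNormalForm.normalForm_two/three/four`; the reindexing permutation is the tree's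
`Literature.NumberTheory.LFunctions.FordVK.exists_perm_zero_one`); then `LowOrderMatrix.false_of_matrix` (first-order kernel vector,
second-order cross-term detector, or the rank-four exit). [cite: Matsumura1987, Thm. 14.2 and Thm. 17.10] [folklore]
-/

-- The namespace mirrors the chain's helper layout (`…Theorems.SwitchingDichotomy.<Piece>`) on purpose.
set_option linter.dupNamespace false

noncomputable section

namespace Summit.ResolutionOfSingularities.ResolutionOfSingularities.Theorems.SwitchingDichotomy.LowOrderUniform

open IsLocalRing Module Literature.AlgebraicGeometry.Resolution
open Summit.ResolutionOfSingularities.ResolutionOfSingularities.Theorems.SwitchingDichotomy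

universe u

/-! ## Coefficient matrices and the unit pair -/

/-- An element of `(u)²` is `Σ_{j,k} G_{jk} u_j u_k`. [folklore] -/
theorem exists_matrix_of_mem_sq {S : Type u} [CommRing S] {n : ℕ} (u : Fin n → S) {F : S}
    (hF : F ∈ Ideal.span (Set.range u) ^ 2) : ∃ G : Fin n → Fin n → S, F = ∑ j, ∑ k, G j k * u j * u k := by
  classical
  rw [pow_two] at hF
  refine Submodule.mul_induction_on hF ?_ ?_
  · intro a ha b hb
    obtain ⟨α, rfl⟩ := Ideal.mem_span_range_iff_exists_fun.mp ha
    obtain ⟨β, rfl⟩ := Ideal.mem_span_range_iff_exists_fun.mp hb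
    refine ⟨fun j k => α j * β k, ?_⟩
    rw [Finset.sum_mul_sum]
    exact Finset.sum_congr rfl fun j _ => Finset.sum_congr rfl fun k _ => by ring
  · rintro a b ⟨Ga, rfl⟩ ⟨Gb, rfl⟩
    refine ⟨fun j k => Ga j k + Gb j k, ?_⟩
    simp only [add_mul, Finset.sum_add_distrib]

/-- Pairing the off-diagonal terms of a double sum: `Σ_{j ≠ k} T_{jk} = Σ_{j < k} (T_{jk} + T_{kj})`. [folklore] -/
theorem sum_offDiag_eq {M : Type u} [AddCommMonoid M] {n : ℕ} (T : Fin n → Fin n → M) :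
    ∑ j, ∑ k, (if j = k then 0 else T j k) = ∑ j, ∑ k, (if j < k then T j k + T k j else 0) := by
  classical
  have h1 : ∀ j k, (if j = k then (0 : M) else T j k) =
      (if j < k then T j k else 0) + (if k < j then T j k else 0) := by
    intro j k
    rcases lt_trichotomy j k with h | h | h
    · rw [if_neg (ne_of_lt h), if_pos h, if_neg (lt_asymm h), add_zero]
    · subst h
      rw [if_pos rfl, if_neg (lt_irrefl j), add_zero]
    · rw [if_neg (ne_of_gt h), if_neg (lt_asymm h), if_pos h, zero_add]
  have h2 : ∀ j k, (if j < k then T j k + T k j else (0 : M)) =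
      (if j < k then T j k else 0) + (if j < k then T k j else 0) := by
    intro j k; split_ifs <;> simp
  simp_rw [h1, h2, Finset.sum_add_distrib]
  congr 1
  rw [Finset.sum_comm]

/-- **`¬High ⇒ a unit pair`.** In a local ring of characteristic `2` whose residues are squares, if the quadratic
expression `F = Σ G_{jk} u_j u_k` (`u_j ∈ 𝔪`) has NO cleaning `F − b²` in `𝔪³`, then some symmetrised off-diagonal
coefficient `G_{jk} + G_{kj}` (`j ≠ k`) is a unit. (Otherwise `b = Σ β_j u_j` with `β_j² ≡ G_{jj}` cleans `F` into
`𝔪³`, pairing the off-diagonal terms.) [folklore] -/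
theorem exists_unit_pair {S : Type u} [CommRing S] [IsLocalRing S] [CharP S 2] {n : ℕ}
    (hperf : ∀ a : S, ∃ b : S, a - b ^ 2 ∈ maximalIdeal S)
    (u : Fin n → S) (hu : ∀ j, u j ∈ maximalIdeal S) (G : Fin n → Fin n → S)
    (hne : ∀ b : S, (∑ j, ∑ k, G j k * u j * u k) - b ^ 2 ∉ maximalIdeal S ^ 3) :
    ∃ j₀ k₀ : Fin n, j₀ ≠ k₀ ∧ IsUnit (G j₀ k₀ + G k₀ j₀) := by
  classical
  by_contra hall
  have hm : ∀ j k, j ≠ k → G j k + G k j ∈ maximalIdeal S := fun j k hjk =>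
    (mem_maximalIdeal _).mpr fun hjk' => hall ⟨j, k, hjk, hjk'⟩
  choose β hβ using fun j => hperf (G j j)
  apply hne (∑ j, β j * u j)
  set T : Fin n → Fin n → S := fun j k => G j k * u j * u k with hT
  -- split the double sum into diagonal and off-diagonal parts
  have hsplit : ∑ j, ∑ k, T j k = ∑ j, T j j + ∑ j, ∑ k, (if j = k then 0 else T j k) := by
    rw [← Finset.sum_add_distrib]
    refine Finset.sum_congr rfl fun j _ => ?_
    have hk : ∀ k, T j k = (if j = k then T j k else 0) + (if j = k then 0 else T j k) := fun k => by
      split_ifs <;> simp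
    rw [Finset.sum_congr rfl fun k _ => hk k, Finset.sum_add_distrib, Finset.sum_ite_eq]
    simp
  have hsq : (∑ j, β j * u j) ^ 2 = ∑ j, β j ^ 2 * u j ^ 2 := by
    rw [sum_pow_char 2]
    exact Finset.sum_congr rfl fun j _ => by ring
  have hkey : (∑ j, ∑ k, G j k * u j * u k) - (∑ j, β j * u j) ^ 2 =
      ∑ j, (G j j - β j ^ 2) * u j ^ 2 + ∑ j, ∑ k, (if j < k then T j k + T k j else 0) := by
    rw [hsq, show (∑ j, ∑ k, G j k * u j * u k) = ∑ j, ∑ k, T j k from rfl, hsplit, sum_offDiag_eq,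
      add_sub_right_comm, ← Finset.sum_sub_distrib]
    congr 1
    exact Finset.sum_congr rfl fun j _ => by simp only [hT]; ring
  rw [hkey]
  have h3 : maximalIdeal S ^ 3 = maximalIdeal S * (maximalIdeal S * maximalIdeal S) := by
    rw [pow_succ, pow_two, mul_comm]
  refine add_mem (Ideal.sum_mem _ fun j _ => ?_) (Ideal.sum_mem _ fun j _ => Ideal.sum_mem _ fun k _ => ?_)
  · rw [h3]
    exact Ideal.mul_mem_mul (hβ j) (by rw [pow_two]; exact Ideal.mul_mem_mul (hu j) (hu j))
  · split_ifs with hjk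
    · have : T j k + T k j = (G j k + G k j) * (u j * u k) := by simp only [hT]; ring
      rw [this, h3]
      exact Ideal.mul_mem_mul (hm j k hjk.ne) (Ideal.mul_mem_mul (hu j) (hu k))
    · exact Ideal.zero_mem _

/-! ## The one-step theorem -/

/-- **`lowOrder_step_two` — LOW ORDER IS ABSORBING (one step, `p = 2`).** Along a 2-steered run (run clause of
`IsSteeredRun` unfolded, centre predicate generic in `Perm` — consumed: a permissible centre has a regular quotient
and an equimultiple cleaning `f − g² ∈ P²`) whose members are local rings at the centre of `O`, with `R (i+1)` regular
of dimension `4` (also `R i`), and square residues: `¬ IsHighOrderAt R s 2 i → ¬ IsHighOrderAt R s 2 (i + 1)`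
(both unfolded). res-L0-w41-tri-2 §σ2.17 (hand proof by centre dimension); here one uniform argument: kernel vector
(first order), completing the product (stage `i`), cross-term detector (second order), rank-four exit.
[cite: Matsumura1987, Thm. 14.2 and Thm. 17.10] [folklore] -/
theorem lowOrder_step_two {K : Type u} [Field K] [CharP K 2]
    (Perm : ∀ S : Subring K, IsLocalRing S → S → Ideal S → Prop)
    (hPerm : ∀ (S : Subring K) (hS : IsLocalRing S) (f : S) (Q : Ideal S),
      Perm S hS f Q → IsRegularLocalRing (S ⧸ Q) ∧ ∃ g : S, f - g ^ 2 ∈ Q ^ 2)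
    (O : ValuationSubring K) (R : ℕ → Subring K) (P : (i : ℕ) → Ideal (R i)) (s : ℕ → K)
    (hrun : ∀ i, ∃ (hL : IsLocalRing (R i)) (hs : s i ^ 2 ∈ R i),
      (Perm (R i) hL ⟨s i ^ 2, hs⟩ (P i) ∨
        (P i = maximalIdeal (R i) ∧ (∀ Q : Ideal (R i), ¬ Perm (R i) hL ⟨s i ^ 2, hs⟩ Q) ∧
          ∃ g : R i, (⟨s i ^ 2, hs⟩ : R i) - g ^ 2 ∈ maximalIdeal (R i) ^ 2)) ∧
      IsLocalBlowupAlong O (R i) (P i) (R (i + 1)) ∧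
      ∃ x g : K, ((∃ hx : x ∈ R i, (⟨x, hx⟩ : R i) ∈ P i) ∧ x ≠ 0 ∧
        ∀ y : R i, y ∈ P i → O.valuation (y : K) ≤ O.valuation x) ∧ g ∈ R i ∧ s i = x * s (i + 1) + g)
    (i : ℕ) (hR : ∀ j, ∃ B : Subring K, B ≤ O.toSubring ∧ R j = locAtCentre B O)
    (hreg : IsRegularLocalRing (R i)) (hreg' : IsRegularLocalRing (R (i + 1)))
    (hdim : ringKrullDim (R i) = 4) (hdim' : ringKrullDim (R (i + 1)) = 4)
    (hperf : ∀ j, ∀ (_ : IsLocalRing (R j)) (a : R j), ∃ b : R j, a - b ^ 2 ∈ maximalIdeal (R j))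
    (hlow : ¬ ∃ (_ : IsLocalRing (R i)) (hs : s i ^ 2 ∈ R i) (g : R i),
      (⟨s i ^ 2, hs⟩ : R i) - g ^ 2 ∈ maximalIdeal (R i) ^ (2 + 1)) :
    ¬ ∃ (_ : IsLocalRing (R (i + 1))) (hs : s (i + 1) ^ 2 ∈ R (i + 1)) (g : R (i + 1)),
      (⟨s (i + 1) ^ 2, hs⟩ : R (i + 1)) - g ^ 2 ∈ maximalIdeal (R (i + 1)) ^ (2 + 1) := by
  classical
  rintro ⟨hL₁, hs₁, g', hg'⟩
  haveI := hreg
  haveI := hreg'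
  obtain ⟨hL, hs, hσ, hbl, x, g₁, ⟨⟨hxR, hxP⟩, hx0, hxmax⟩, hg₁, hstep⟩ := hrun i
  obtain ⟨B, hB, hRB⟩ := hR i
  obtain ⟨B₁, hB₁, hR₁B⟩ := hR (i + 1)
  have hperfR : ∀ a : R i, ∃ b : R i, a - b ^ 2 ∈ maximalIdeal (R i) := hperf i inferInstance
  have hperfR₁ : ∀ a : R (i + 1), ∃ b : R (i + 1), a - b ^ 2 ∈ maximalIdeal (R (i + 1)) :=
    hperf (i + 1) inferInstance
  -- ### the centre: regular quotient and an equimultiple cleaning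
  have hcentre : ∃ (_ : IsRegularLocalRing (R i ⧸ P i)) (gσ : R i),
      (⟨s i ^ 2, hs⟩ : R i) - gσ ^ 2 ∈ P i ^ 2 := by
    rcases hσ with hperm | ⟨hPm, -, gσ, hgσ⟩
    · obtain ⟨hq, gσ, hh⟩ := hPerm _ hL _ _ hperm
      exact ⟨hq, gσ, hh⟩
    · have hq : IsRegularLocalRing (R i ⧸ P i) := by
        rw [hPm]
        letI := Ideal.Quotient.field (maximalIdeal (R i))
        infer_instance
      refine ⟨hq, gσ, ?_⟩
      rw [hPm]
      exact hgσ
  obtain ⟨hq, gσ, hF⟩ := hcentre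
  haveI := hq
  have hPtop : P i ≠ ⊤ := by
    intro hh
    have hsub : Subsingleton (R i ⧸ P i) := Ideal.Quotient.subsingleton_iff.mpr hh
    exact not_subsingleton (R i ⧸ P i) hsub
  have hPle : P i ≤ maximalIdeal (R i) := IsLocalRing.le_maximalIdeal hPtop
  -- ### the centre is generated by part of a regular system of parameters
  obtain ⟨r, ugen, hpart, hPu⟩ := exists_isRsopPart_span_range_eq hPle
  obtain ⟨-, e, wgen, hdimre, huw⟩ := hpart
  have hre : r + e = 4 := by
    rw [hdimre] at hdim
    exact_mod_cast hdim
  have hugen : ∀ j, ugen j ∈ maximalIdeal (R i) := fun j => hPle (hPu ▸ Ideal.subset_span ⟨j, rfl⟩)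
  -- ### the coefficient matrix and the unit pair
  obtain ⟨G, hG⟩ := exists_matrix_of_mem_sq ugen (hPu ▸ hF : (⟨s i ^ 2, hs⟩ : R i) - gσ ^ 2 ∈ _)
  have hne : ∀ b : R i, (∑ j, ∑ k, G j k * ugen j * ugen k) - b ^ 2 ∉ maximalIdeal (R i) ^ 3 := by
    intro b hb
    apply hlow
    refine ⟨inferInstance, hs, gσ + b, ?_⟩
    have : (⟨s i ^ 2, hs⟩ : R i) - (gσ + b) ^ 2 = (∑ j, ∑ k, G j k * ugen j * ugen k) - b ^ 2 := by
      rw [← hG, CharTwo.add_sq]; ring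
    rw [this]
    exact hb
  obtain ⟨j₀, k₀, hjk, hunit⟩ := exists_unit_pair hperfR ugen hugen G hne
  -- ### reindex so that the unit pair is `(0, 1)`
  obtain ⟨r', rfl⟩ : ∃ r', r = r' + 2 := ⟨r - 2, by
    have h1 := j₀.isLt; have h2 := k₀.isLt; have h3 := Fin.val_ne_of_ne hjk; omega⟩
  -- (the reindexing permutation is the tree's `FordVK.exists_perm_zero_one`, same statement)
  obtain ⟨σp, hσ0, hσ1⟩ := Literature.NumberTheory.LFunctions.FordVK.exists_perm_zero_one j₀ k₀ hjk
  set uσ : Fin (r' + 2) → R i := ugen ∘ σp with huσ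
  set Gσ : Fin (r' + 2) → Fin (r' + 2) → R i := fun j k => G (σp j) (σp k) with hGσ
  have hspanσ : Ideal.span (Set.range uσ) = P i := by
    rw [huσ, σp.surjective.range_comp]; exact hPu
  have hFσ : (⟨s i ^ 2, hs⟩ : R i) - gσ ^ 2 = ∑ j, ∑ k, Gσ j k * uσ j * uσ k := by
    rw [hG]
    simp only [hGσ, huσ, Function.comp_apply]
    rw [show (∑ x, ∑ y, G (σp x) (σp y) * ugen (σp x) * ugen (σp y)) =
        ∑ x, ∑ k, G (σp x) k * ugen (σp x) * ugen k from
      Finset.sum_congr rfl fun x _ => Equiv.sum_comp σp (fun k => G (σp x) k * ugen (σp x) * ugen k)]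
    exact (Equiv.sum_comp σp (fun j => ∑ k, G j k * ugen j * ugen k)).symm
  have hunitσ : IsUnit (Gσ 0 1 + Gσ 1 0) := by simpa [hGσ, hσ0, hσ1] using hunit
  obtain ⟨mui, hmui⟩ := hunitσ.exists_right_inv
  -- helper: from `(u') = (u)` to the generation of `𝔪` together with `wgen`
  have hmax : ∀ u' : Fin (r' + 2) → R i, Ideal.span (Set.range u') = Ideal.span (Set.range uσ) →
      Ideal.span (Set.range u' ∪ Set.range wgen) = maximalIdeal (R i) := by
    intro u' hu'
    rw [Ideal.span_union, hu', huσ, σp.surjective.range_comp, ← Ideal.span_union]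
    exact huw
  -- ### the common call of the engines
  have call : ∀ (u' : Fin (r' + 2) → R i) (G' : Fin (r' + 2) → Fin (r' + 2) → R i),
      Ideal.span (Set.range u') = Ideal.span (Set.range uσ) →
      (⟨s i ^ 2, hs⟩ : R i) - gσ ^ 2 = ∑ j, ∑ k, G' j k * u' j * u' k →
      ((∃ j₁ j₂ : Fin (r' + 2), j₁ ≠ j₂ ∧ IsUnit (G' j₁ j₂) ∧
          ∀ j k, j ≠ k → ¬ (j = j₁ ∧ k = j₂) → G' j k ∈ maximalIdeal (R i)) ∨
        (∃ j₁ j₂ j₃ j₄ : Fin (r' + 2), j₁ ≠ j₂ ∧ j₁ ≠ j₃ ∧ j₁ ≠ j₄ ∧ j₂ ≠ j₃ ∧ j₂ ≠ j₄ ∧ j₃ ≠ j₄ ∧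
          (∀ j, j = j₁ ∨ j = j₂ ∨ j = j₃ ∨ j = j₄) ∧ IsUnit (G' j₁ j₂) ∧ IsUnit (G' j₃ j₄) ∧
          ∀ j k, j ≠ k → ¬ (j = j₁ ∧ k = j₂) → ¬ (j = j₃ ∧ k = j₄) → G' j k ∈ maximalIdeal (R i))) → False := by
    intro u' G' hu' hF' hcase
    exact LowOrderMatrix.false_of_matrix O (R i) (R (i + 1)) B B₁ hB hB₁ hRB hR₁B (P i) hbl hdim' hperfR hperfR₁
      x hxR hxP hx0 hxmax (s i) (s (i + 1)) g₁ hg₁ hstep hs hs₁ hre u' wgen (hmax u' hu') (hu'.trans hspanσ)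
      G' gσ hF' hcase ⟨g', hg'⟩
  -- ### normal forms by the number of generators
  rcases r' with _ | _ | _ | r3
  · -- two generators
    obtain ⟨G', hFeq, h01, hzero⟩ := LowOrderNormalForm.normalForm_two uσ Gσ
    refine call uσ G' rfl (hFσ.trans hFeq) (Or.inl ⟨0, 1, by decide, h01 ▸ hunitσ, fun j k hjk h01' => ?_⟩)
    rw [hzero j k hjk h01']
    exact Ideal.zero_mem _
  · -- three generators
    obtain ⟨u', G', hu', hFeq, h01, hzero⟩ := LowOrderNormalForm.normalForm_three uσ Gσ mui hmui
    refine call u' G' hu' (hFσ.trans hFeq) (Or.inl ⟨0, 1, by decide, h01 ▸ hunitσ, fun j k hjk h01' => ?_⟩)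
    rw [hzero j k hjk h01']
    exact Ideal.zero_mem _
  · -- four generators: rank two or rank four
    obtain ⟨u', G', hu', hFeq, h01, -, hzero⟩ := LowOrderNormalForm.normalForm_four uσ Gσ mui hmui
    by_cases hν : IsUnit (G' 2 3)
    · refine call u' G' hu' (hFσ.trans hFeq) (Or.inr ⟨0, 1, 2, 3, by decide, by decide, by decide, by decide,
        by decide, by decide, fun j => ?_, h01 ▸ hunitσ, hν, fun j k hjk h01' h23 => ?_⟩)
      · fin_cases j <;> simp
      · rw [hzero j k hjk h01' h23]
        exact Ideal.zero_mem _
    · refine call u' G' hu' (hFσ.trans hFeq) (Or.inl ⟨0, 1, by decide, h01 ▸ hunitσ, fun j k hjk h01' => ?_⟩)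
      by_cases h23 : j = 2 ∧ k = 3
      · obtain ⟨rfl, rfl⟩ := h23
        exact (mem_maximalIdeal _).mpr hν
      · rw [hzero j k hjk h01' h23]
        exact Ideal.zero_mem _
  · -- five or more generators cannot be part of a regular system of parameters of a 4-dimensional ring
    omega

end Summit.ResolutionOfSingularities.ResolutionOfSingularities.Theorems.SwitchingDichotomy.LowOrderUniform

end
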